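import Literature.NumberTheory.EllipticCurves.InertiaTameFactorizationProofs
import HarnessLib

/-!
# A global character of exponent `n` is unramified at a finite place `v ∤ n` with
# `gcd(n, N v - 1) = 1` (tame inertia and Frobenius: `θ(F σ F⁻¹) = θ(σ)^{N v}`)

Topic `Literature/NumberTheory/GaloisRepresentations`. PROOF-ONLY file (theorems, no definition, no
named fact). For a number field `K`, a finite place `v` with residue cardinality `q = N v`, a prime
`𝔓` of `\bar ℤ_K` above `v`, an integer `n ≥ 1` with `v ∤ n`, and a **global** continuous
homomorphism `χ : Γ_K → T` into a discrete abelian group killed by `n` (e.g. a class of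
`H¹(K, ℤ/n) = Hom_cont(Γ_K, ℤ/n)`), we prove

* `apply_conj_frob_eq_residueCard_nsmul` — for an arithmetic Frobenius `F ∈ Γ_K` at `𝔓` and every
  `σ ∈ I_𝔓`: `F σ F⁻¹ ∈ I_𝔓` and **`χ(F σ F⁻¹) = q · χ(σ)`**. This is Serre's relation
  `θ(F σ F⁻¹) = θ(σ)^q` for the characters `θ` of the tame inertia group (J.-P. Serre,
  *Propriétés galoisiennes des points d'ordre fini des courbes elliptiques*, Invent. Math. 15
  (1972), §1.8 Prop. 6 / §1.3 Prop. 2), transported to `χ|_{I_𝔓}` through the tree's tame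
  factorization `InertiaTame.apply_eq_apply_of_smul_root_eq` (`χ|_{I_𝔓}` is a function of the
  Kummer character `σ ↦ σ(π^{1/n})/π^{1/n}`) and Mathlib's `AlgHom.IsArithFrobAt.apply_of_pow_eq_one`
  (`F ζ = ζ^q` on `μ_n ⊂ \bar ℤ_K`).
* `residueCard_sub_one_nsmul_apply_eq_zero` — hence **`(q - 1) · χ(σ) = 0`** for `σ ∈ I_𝔓`
  (`χ` is a homomorphism on all of `Γ_K` with abelian target, so `χ(F σ F⁻¹) = χ(σ)`).
* `apply_eq_zero_of_mem_inertia_of_coprime` (**main**) — if moreover `gcd(n, q - 1) = 1` then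
  **`χ(σ) = 0` for every `σ ∈ I_𝔓`**: `χ` is unramified at `v`. This is the elementary half of
  the local structure of characters (Serre, *Local Fields*, Ch. XV §2 / Ch. IV §2: a tamely ramified
  character of `Gal(\bar K_v/K_v)` of order prime to `q - 1` is unramified, the tame inertia
  quotient being `≅ \varprojlim 𝔽_{q^m}^×` on which the characters defined over `K_v` factor through
  `𝔽_q^×`), in the global form used by descents with constant kernel `ℤ/n` (B. Mazur, *Modular
  curves and the Eisenstein ideal*, Publ. Math. IHÉS 47 (1977), Ch. I §1(g), the table of
  `h¹(Spec ℤ[1/N], ℤ/p)`: a `ℤ/p`-extension of `ℚ` can only ramify at `p` and at primes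
  `ℓ ≡ 1 (mod p)`).

## References

* [SerreInventiones1972] J.-P. Serre, *Propriétés galoisiennes des points d'ordre fini des courbes
  elliptiques*, Invent. Math. 15 (1972), §1.3 Prop. 2, §1.8 Prop. 6.
* [Mazur1977] B. Mazur, *Modular curves and the Eisenstein ideal*, Publ. Math. IHÉS 47 (1977),
  Ch. I §1(g) (table p. 48).
* [NeukirchANT1999] J. Neukirch, *Algebraic Number Theory* (1999), Ch. I §9 (Frobenius, inertia).

## Design

Theorems only; conventions of `InertiaTameFactorizationProofs` (`K : Type u`, `χ` given as a bare
function with its homomorphism property `hχ` and `Continuous χ`, the target `T` an additive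
discrete finite group with `n • t = 0`). The Frobenius is any `F` with Mathlib's
`IsArithFrobAt (𝓞 K) F 𝔓` for the action of `Γ_K` on `\bar ℤ_K = absIntegers (𝓞 K) K`
(such `F` exist: `HeightOneSpectrum.exists_isArithFrobAt_of_mem_primesAbove_holds`).
-/

noncomputable section

open scoped Classical Pointwise
open NumberField IsDedekindDomain Field WithZero
open Literature.NumberTheory.EllipticCurves Literature.NumberTheory.GaloisRepresentations

universe u

namespace Literature.NumberTheory.GaloisRepresentations

namespace GlobalCharacter

variable {K : Type u} [Field K] [NumberField K] (v : HeightOneSpectrum (𝓞 K))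

omit [NumberField K] in
/-- Conjugation by an element of the decomposition group (`F • 𝔓 = 𝔓`) preserves the inertia group
`I_𝔓 ≤ Γ_K`: `F σ F⁻¹ ∈ I_𝔓` for `σ ∈ I_𝔓` (Neukirch: `G_{σ𝔓} = σ G_𝔓 σ⁻¹`, `I_{σ𝔓} = σ I_𝔓 σ⁻¹`).
[cite: NeukirchANT1999, Ch. I §9 Prop. (9.4)] -/
theorem conj_mem_inertia {𝔓 : Ideal (absIntegers (𝓞 K) K)} {F : absoluteGaloisGroup K}
    (hF : F • 𝔓 = 𝔓) {σ : absoluteGaloisGroup K} (hσ : σ ∈ 𝔓.inertia (absoluteGaloisGroup K)) :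
    F * σ * F⁻¹ ∈ 𝔓.inertia (absoluteGaloisGroup K) := by
  intro x
  have h1 : (F * σ * F⁻¹) • x - x = F • (σ • (F⁻¹ • x) - F⁻¹ • x) := by
    simp only [smul_sub, mul_smul, smul_inv_smul]
  rw [Submodule.mem_toAddSubgroup, h1]
  have h2 : F • (σ • (F⁻¹ • x) - F⁻¹ • x) ∈ F • 𝔓 :=
    Ideal.smul_mem_pointwise_smul F _ 𝔓 (hσ (F⁻¹ • x))
  rwa [hF] at h2

/-- An arithmetic Frobenius `F` at a prime `𝔓 ∣ v` of `\bar ℤ_K` raises the roots of unity of order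
prime to `v` to the power `q = N v`: `F ζ = ζ ^ q` for `ζ ∈ K̄` with `ζ ^ n = 1`, `v ∤ n` (the roots
of unity of order `n` stay distinct modulo `𝔓`; Mathlib `AlgHom.IsArithFrobAt.apply_of_pow_eq_one`).
[cite: NeukirchANT1999, Ch. I §10 Prop. (10.4)] -/
theorem frob_smul_eq_pow_of_pow_eq_one {n : ℕ} (hnv : (n : 𝓞 K) ∉ v.asIdeal)
    {𝔓 : Ideal (absIntegers (𝓞 K) K)} (h𝔓 : 𝔓 ∈ v.primesAbove) {F : absoluteGaloisGroup K}
    (hF : IsArithFrobAt (𝓞 K) F 𝔓) {ζ : AlgebraicClosure K} (hζ : ζ ^ n = 1) :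
    F • ζ = ζ ^ v.residueCard := by
  rcases Nat.eq_zero_or_pos n with rfl | hn
  · exact absurd (by simp) hnv
  have hint : IsIntegral (𝓞 K) ζ := IsIntegral.of_pow hn (by rw [hζ]; exact isIntegral_one)
  set y : absIntegers (𝓞 K) K := ⟨ζ, (mem_integralClosure_iff _ _).mpr hint⟩ with hy
  have hyn : y ^ n = 1 := Subtype.ext (by
    rw [SubmonoidClass.coe_pow, OneMemClass.coe_one]; exact hζ)
  haveI := h𝔓.1
  have hnP : ((n : ℕ) : absIntegers (𝓞 K) K) ∉ 𝔓 := by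
    intro h
    apply hnv
    have h2 : algebraMap (𝓞 K) (absIntegers (𝓞 K) K) (n : 𝓞 K) ∈ 𝔓 := by
      rwa [map_natCast]
    rw [← Ideal.mem_comap] at h2
    have h3 : v.asIdeal = 𝔓.comap (algebraMap (𝓞 K) (absIntegers (𝓞 K) K)) := h𝔓.2.over
    rwa [h3]
  have key := AlgHom.IsArithFrobAt.apply_of_pow_eq_one hF hyn hnP
  rw [HeightOneSpectrum.card_quotient_under_eq_residueCard h𝔓] at key
  have key' := congrArg (fun z : absIntegers (𝓞 K) K ↦ (z : AlgebraicClosure K)) key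
  simp only [MulSemiringAction.toAlgHom_apply, SubmonoidClass.coe_pow] at key'
  rw [← key']
  rfl

/-- **Serre's relation `θ(F σ F⁻¹) = θ(σ)^q` for a global character on inertia.** Let `χ : Γ_K → T`
be a continuous homomorphism into a finite discrete abelian group killed by `n`, `v ∤ n`, `𝔓 ∣ v`,
and `F` an arithmetic Frobenius at `𝔓`. Then for every `σ ∈ I_𝔓`: `χ(F σ F⁻¹) = q • χ(σ)` with
`q = N v`. Proof: `χ|_{I_𝔓}` is a function of the Kummer character `θ_z(σ) = σ(z)/z`,
`z^n = π` a uniformizer (tree `InertiaTame.apply_eq_apply_of_smul_root_eq`); by the conjugation law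
(`InertiaTame.ringEquiv_apply_apply_symm_root`) `θ_z(F σ F⁻¹) = F(θ_z(σ)) = θ_z(σ)^q = θ_z(σ^q)`,
the middle step being `F ζ = ζ^q` on `μ_n`. [cite: SerreInventiones1972, §1.8 Prop. 6] -/
theorem apply_conj_frob_eq_residueCard_nsmul {n : ℕ} (hn : 0 < n) (hnv : (n : 𝓞 K) ∉ v.asIdeal)
    {𝔓 : Ideal (absIntegers (𝓞 K) K)} (h𝔓 : 𝔓 ∈ v.primesAbove)
    {T : Type*} [AddCommGroup T] [Finite T] [TopologicalSpace T] [DiscreteTopology T]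
    (hT : ∀ t : T, n • t = 0)
    (χ : absoluteGaloisGroup K → T) (hχc : Continuous χ) (hχ : ∀ σ τ, χ (σ * τ) = χ σ + χ τ)
    {F : absoluteGaloisGroup K} (hF : IsArithFrobAt (𝓞 K) F 𝔓)
    {σ : absoluteGaloisGroup K} (hσ : σ ∈ 𝔓.inertia (absoluteGaloisGroup K)) :
    χ (F * σ * F⁻¹) = v.residueCard • χ σ := by
  haveI := h𝔓.1
  -- a uniformizer `π` at `v` and a root `z ^ n = π` in `K̄`
  obtain ⟨π, hπ⟩ := v.valuation_exists_uniformizer K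
  obtain ⟨z, hz⟩ := IsAlgClosed.exists_pow_nat_eq (algebraMap K (AlgebraicClosure K) π) hn
  have hz0 : z ≠ 0 := by
    intro h0
    rw [h0, zero_pow hn.ne', eq_comm, map_eq_zero] at hz
    rw [hz, map_zero] at hπ
    exact exp_ne_zero hπ.symm
  -- the restriction `a = χ|_{I_𝔓}`
  set a : 𝔓.inertia (absoluteGaloisGroup K) → T := fun s ↦ χ s with ha_def
  have hac : Continuous a := hχc.comp continuous_subtype_val
  have ha : ∀ s t, a (s * t) = a s + a t := fun s t ↦ hχ s t
  -- `F` stabilises `𝔓`, so `F σ F⁻¹ ∈ I_𝔓`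
  have hFmem : F ∈ MulAction.stabilizer (absoluteGaloisGroup K) 𝔓 := hF.mem_stabilizer
  have hFP : F • 𝔓 = 𝔓 := MulAction.mem_stabilizer_iff.mp hFmem
  have hτ : F * σ * F⁻¹ ∈ 𝔓.inertia (absoluteGaloisGroup K) := conj_mem_inertia hFP hσ
  -- `θ_z(σ) = ζ`, an `n`-th root of unity
  have hπfix : ∀ g : absoluteGaloisGroup K, g • algebraMap K (AlgebraicClosure K) π =
      algebraMap K (AlgebraicClosure K) π := fun g ↦ by
    rw [absoluteGaloisGroup.smul_def, AlgEquiv.commutes]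
  set ζ : AlgebraicClosure K := σ • z / z with hζ_def
  have hζn : ζ ^ n = 1 := InertiaTame.smul_div_pow_eq_one hz hz0 (hπfix σ)
  have hσz : σ • z = ζ * z := by rw [hζ_def, div_mul_cancel₀ _ hz0]
  -- `σ ^ m • z = ζ ^ m * z`
  have hpow : ∀ m : ℕ, (σ ^ m) • z = ζ ^ m * z := by
    intro m
    induction m with
    | zero => rw [pow_zero, one_smul, pow_zero, one_mul]
    | succ m ih =>
      rw [pow_succ', mul_smul, ih, smul_mul', hσz,
        InertiaTame.smul_eq_of_mem_inertia_of_pow_eq_one v hn hnv h𝔓 hσ (ζ := ζ ^ m)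
          (by rw [← pow_mul, mul_comm, pow_mul, hζn, one_pow])]
      ring
  -- the conjugation law: `(F σ F⁻¹) • z = F(θ_z(σ)) * z = ζ ^ q * z`
  set t : AlgebraicClosure K ≃+* AlgebraicClosure K :=
    (absoluteGaloisGroup.toAlgEquiv K F).toRingEquiv with ht_def
  have ht_apply : ∀ w, t w = F • w := fun w ↦ rfl
  have ht_symm : ∀ w, t.symm w = F⁻¹ • w := fun w ↦ by
    rw [absoluteGaloisGroup.smul_def, map_inv, AlgEquiv.aut_inv]
    rfl
  have hs : ∀ ξ : AlgebraicClosure K, ξ ^ n = 1 → ∀ w : AlgebraicClosure K,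
      σ • (ξ * w) = ξ * σ • w := fun ξ hξ w ↦ by
    rw [smul_mul', InertiaTame.smul_eq_of_mem_inertia_of_pow_eq_one v hn hnv h𝔓 hσ hξ]
  have hconj := InertiaTame.ringEquiv_apply_apply_symm_root t hz hz0
    (by rw [ht_apply]; exact hπfix F) (fun w ↦ σ • w) hs
  -- `F ζ = ζ ^ q`
  have hFζ : F • ζ = ζ ^ v.residueCard := frob_smul_eq_pow_of_pow_eq_one v hnv h𝔓 hF hζn
  have h1 : (F * σ * F⁻¹) • z = (σ ^ v.residueCard) • z := by
    rw [hpow, mul_smul, mul_smul, ← ht_symm, ← ht_apply, hconj, ht_apply, ← hζ_def, hFζ]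
  -- tame factorization: `a` depends only on `θ_z`
  have h2 := InertiaTame.apply_eq_apply_of_smul_root_eq v hn hnv hπ hz h𝔓 hT a hac ha
    (σ := ⟨F * σ * F⁻¹, hτ⟩) (σ' := ⟨σ, hσ⟩ ^ v.residueCard)
    (by rw [Subgroup.coe_pow]; exact h1)
  rw [InertiaTame.apply_pow_eq_nsmul a ha] at h2
  exact h2

/-- **`(N v - 1) · χ(σ) = 0` on inertia** for a global continuous homomorphism `χ : Γ_K → T`
(`n • T = 0`, `v ∤ n`, `σ ∈ I_𝔓`, `𝔓 ∣ v`): `χ(F σ F⁻¹) = χ(σ)` because `T` is abelian, and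
`χ(F σ F⁻¹) = q • χ(σ)` (`apply_conj_frob_eq_residueCard_nsmul`).
[cite: SerreInventiones1972, §1.8 Prop. 6] -/
theorem residueCard_sub_one_nsmul_apply_eq_zero {n : ℕ} (hn : 0 < n)
    (hnv : (n : 𝓞 K) ∉ v.asIdeal) {𝔓 : Ideal (absIntegers (𝓞 K) K)} (h𝔓 : 𝔓 ∈ v.primesAbove)
    {T : Type*} [AddCommGroup T] [Finite T] [TopologicalSpace T] [DiscreteTopology T]
    (hT : ∀ t : T, n • t = 0)
    (χ : absoluteGaloisGroup K → T) (hχc : Continuous χ) (hχ : ∀ σ τ, χ (σ * τ) = χ σ + χ τ)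
    {σ : absoluteGaloisGroup K} (hσ : σ ∈ 𝔓.inertia (absoluteGaloisGroup K)) :
    (v.residueCard - 1) • χ σ = 0 := by
  obtain ⟨F, hF⟩ := HeightOneSpectrum.exists_isArithFrobAt_of_mem_primesAbove_holds h𝔓
  have h1 := apply_conj_frob_eq_residueCard_nsmul v hn hnv h𝔓 hT χ hχc hχ hF hσ
  have hone : χ 1 = 0 := by
    have := hχ 1 1
    rw [mul_one] at this
    exact left_eq_add.mp this
  have hinv : χ F⁻¹ = - χ F := by
    have := hχ F F⁻¹
    rw [mul_inv_cancel, hone] at this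
    exact (neg_eq_of_add_eq_zero_right this.symm).symm
  have h2 : χ (F * σ * F⁻¹) = χ σ := by
    rw [hχ, hχ, hinv]; abel
  have hq : 1 ≤ v.residueCard := v.one_lt_residueCard.le
  rw [h2] at h1
  have h3 : (v.residueCard - 1) • χ σ + χ σ = v.residueCard • χ σ := by
    conv_rhs => rw [← Nat.sub_add_cancel hq]
    rw [add_nsmul, one_nsmul]
  have h4 : (v.residueCard - 1) • χ σ + χ σ = 0 + χ σ := by rw [h3, ← h1, zero_add]
  exact add_right_cancel h4

/-- **A global character of exponent `n` is unramified at `v` when `v ∤ n` and `gcd(n, N v - 1) = 1`.**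
For a number field `K`, a finite place `v` with `v ∤ n` and `Nat.Coprime n (N v - 1)`, a prime `𝔓`
of `\bar ℤ_K` above `v`, and a continuous homomorphism `χ : Γ_K → T` into a finite discrete abelian
group with `n • T = 0`: `χ(σ) = 0` for every `σ ∈ I_𝔓`. (The order of `χ(σ)` divides both `n` and
`N v - 1`.) For `K = ℚ`, `T = ℤ/p`: a `ℤ/p`-extension of `ℚ` is unramified at every prime
`ℓ ≠ p` with `ℓ ≢ 1 (mod p)` — the vanishing of the local terms at such `ℓ` in Mazur's table of
`h¹(Spec ℤ[1/N], ℤ/p)`. [cite: Mazur1977, Ch. I §1(g)] [cite: SerreInventiones1972, §1.3 Prop. 2] -/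
theorem apply_eq_zero_of_mem_inertia_of_coprime {n : ℕ} (hn : 0 < n)
    (hnv : (n : 𝓞 K) ∉ v.asIdeal) (hcop : Nat.Coprime n (v.residueCard - 1))
    {𝔓 : Ideal (absIntegers (𝓞 K) K)} (h𝔓 : 𝔓 ∈ v.primesAbove)
    {T : Type*} [AddCommGroup T] [Finite T] [TopologicalSpace T] [DiscreteTopology T]
    (hT : ∀ t : T, n • t = 0)
    (χ : absoluteGaloisGroup K → T) (hχc : Continuous χ) (hχ : ∀ σ τ, χ (σ * τ) = χ σ + χ τ)
    {σ : absoluteGaloisGroup K} (hσ : σ ∈ 𝔓.inertia (absoluteGaloisGroup K)) :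
    χ σ = 0 := by
  have h1 := residueCard_sub_one_nsmul_apply_eq_zero v hn hnv h𝔓 hT χ hχc hχ hσ
  have h2 : n • χ σ = 0 := hT _
  have hd1 : addOrderOf (χ σ) ∣ n := addOrderOf_dvd_of_nsmul_eq_zero h2
  have hd2 : addOrderOf (χ σ) ∣ v.residueCard - 1 := addOrderOf_dvd_of_nsmul_eq_zero h1
  have h3 : addOrderOf (χ σ) = 1 := Nat.eq_one_of_dvd_coprimes hcop hd1 hd2
  exact AddMonoid.addOrderOf_eq_one_iff.mp h3

/-- Specialisation to `K = ℚ`-style data: with `v ∤ n`, `Nat.Coprime n (N v - 1)`, a continuous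
homomorphism `χ : Γ_K → T` (`n • T = 0`) **vanishes on the inertia group of every prime above `v`**.
[cite: Mazur1977, Ch. I §1(g)] -/
theorem forall_inertia_apply_eq_zero_of_coprime {n : ℕ} (hn : 0 < n)
    (hnv : (n : 𝓞 K) ∉ v.asIdeal) (hcop : Nat.Coprime n (v.residueCard - 1))
    {T : Type*} [AddCommGroup T] [Finite T] [TopologicalSpace T] [DiscreteTopology T]
    (hT : ∀ t : T, n • t = 0)
    (χ : absoluteGaloisGroup K → T) (hχc : Continuous χ) (hχ : ∀ σ τ, χ (σ * τ) = χ σ + χ τ) :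
    ∀ 𝔓 ∈ v.primesAbove, ∀ σ ∈ 𝔓.inertia (absoluteGaloisGroup K), χ σ = 0 :=
  fun _ h𝔓 _ hσ ↦ apply_eq_zero_of_mem_inertia_of_coprime v hn hnv hcop h𝔓 hT χ hχc hχ hσ

end GlobalCharacter

end Literature.NumberTheory.GaloisRepresentations

end
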